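import Mathlib
import Summits.NavierStokesRegularity.NavierStokesRegularity.Theorems.FilamentSkeletonRssDefectColumnGateDefs
import Literature.Analysis.FluidPDE.LagrangianTimeDerivativeTools
import Literature.Analysis.FluidPDE.StretchingRateDynamics
import Summits.NavierStokesRegularity.NavierStokesRegularity.Theorems.FilamentSkeletonRssNormalVariationRigidity
import Summits.NavierStokesRegularity.NavierStokesRegularity.Theorems.FilamentSkeletonRssTransverseReductionRCensus

/-!
# Route `FilamentSkeletonRss` · crux `TransverseReduction1AL` (stmt-NavierStokesRegularity-23297) · line `defect_column_gate_1AL` —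
# THE SECTION OF THE S2a-loc CLASS IN AN ARBITRARY ORTHONORMAL FRAME (kinematic tools)

Helper file (`--supports stmt-NavierStokesRegularity-23297 --as helper`; LEAD of 23297, lane ns-filament-21221-p1 g12), first of two.  Stub
S2a-loc `WaistColumnGateLoc1A` (`Theorems/FilamentSkeletonRssDefectColumnGateDefs.lean` §7; same text on the aside 27853 and on the live L-twin
23297) quantifies over fields `W : ℝ³ → ℝ³` vanishing outside the sectional cylinder `|y|² − ⟨y,d⟩² ≥ R²` about the axis `ℝd` of an orthonormal
frame `(d; m, n)` WHOSE ORIENTATION IS NOT FIXED, and states its moment clauses on the section `ξ ↦ secPt d m n τ ξ = τd + ξ₀m + ξ₁n`.  This file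
supplies the frame-free calculus the sectional moment identities need (second file: `…DefectColumnGateSectionalMoments.lean`):

* `cross_eq_orientationSign_smul`, `orientationSign_sq` — `m × n = ε d` with the ORIENTATION SIGN `ε = ⟨m × n, d⟩`, `ε² = 1`;
* **`inner_curl_axis_eq`** — `⟨curl W y, d⟩ = ε (⟨n, DW(y) m⟩ − ⟨m, DW(y) n⟩)` for every field and every orthonormal frame (from the
  tree's `inner_cross_curl`);
* `hasFDerivAt_secPt`, `contDiff_secPt`, `fderiv_inner_comp_secPt(_single₀/₁)` — chain rule along the section: `∂₀⟨u, W∘secPt⟩ = ⟨u, DW m⟩`,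
  `∂₁⟨u, W∘secPt⟩ = ⟨u, DW n⟩`;
* `inner_secPt_axis`, `norm_secPt_sq`, **`secWt_secPt`** — on the section `⟨y,d⟩ = τ`, `|y|² = τ² + |ξ|²`, so the stub's weight is
  `secWt d y = 1 + |ξ|²` and `|y|² − ⟨y,d⟩² = |ξ|²`;
* **`hasCompactSupport_comp_secPt`** — the localisation clause of the stub makes every section trace `ξ ↦ W(secPt d m n τ ξ)` COMPACTLY
  SUPPORTED (in the closed disc of radius `|R|`), the form in which integration by parts in the section is licensed;
* `integral_mul_fderiv_apply_eq_neg`, `integral_fderiv_apply_eq_zero₂` — `∫ p ∂_v w = −∫ (∂_v p) w` on `ℝ²` for `C¹` data with `w` compactly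
  supported (Mathlib's `integral_mul_fderiv_eq_neg_fderiv_mul_of_integrable`), and the coordinate derivatives `fderiv_coord_single`,
  `fderiv_coord_mul`, `fderiv_coord_sq_sub` of the weights `ξᵢ`, `ξ₀ξ₁`, `ξ₀² − ξ₁²`.

HONEST FRAMING: elementary calculus about the KINEMATIC class of ONE linear MODEL operator of a hypothetical blow-up route (MODEL rung, negative
side); no stub is proved; `WaistColumnGateLoc1A` and `TransverseReduction1AL` are neither proved nor refuted; nothing here bears on Navier–Stokes
regularity.
-/

set_option linter.dupNamespace false

noncomputable section

namespace Summit.NavierStokesRegularity.NavierStokesRegularity.Theorems.DefectColumnGate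

open scoped BigOperators InnerProductSpace
open MeasureTheory Set Function
open Literature.Analysis.FluidPDE

/-! ## 1. Frame algebra: the axial vorticity in an arbitrary orthonormal frame -/

/-- In an orthonormal frame `(d; m, n)` of `ℝ³`: `m × n = ε d` with `ε = ⟨m × n, d⟩` and `ε² = 1` (`ε = ±1` is the orientation of the
frame, which stub S2a-loc leaves free). -/
theorem cross_eq_orientationSign_smul {d m n : EuclideanSpace ℝ (Fin 3)} (hon : Orthonormal ℝ ![d, m, n]) :
    cross m n = ⟪cross m n, d⟫_ℝ • d ∧ ⟪cross m n, d⟫_ℝ ^ 2 = 1 := by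
  -- the frame is an orthonormal basis of `ℝ³`
  have hcard : Fintype.card (Fin 3) = Module.finrank ℝ (EuclideanSpace ℝ (Fin 3)) := by simp
  have hcoe : ((basisOfOrthonormalOfCardEqFinrank hon hcard : Module.Basis (Fin 3) ℝ (EuclideanSpace ℝ (Fin 3))) : Fin 3 → _) =
      ![d, m, n] :=
    coe_basisOfOrthonormalOfCardEqFinrank hon hcard
  have hon' : Orthonormal ℝ (basisOfOrthonormalOfCardEqFinrank hon hcard : Module.Basis (Fin 3) ℝ (EuclideanSpace ℝ (Fin 3))) := by
    rw [hcoe]; exact hon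
  let b : OrthonormalBasis (Fin 3) ℝ (EuclideanSpace ℝ (Fin 3)) := (basisOfOrthonormalOfCardEqFinrank hon hcard).toOrthonormalBasis hon'
  have hb : ∀ i, b i = ![d, m, n] i := fun i => by
    have h := congrFun hcoe i
    simp only [b, Module.Basis.coe_toOrthonormalBasis]
    exact h
  have hexp := b.sum_repr' (cross m n)
  rw [Fin.sum_univ_three, hb, hb, hb] at hexp
  simp only [Matrix.cons_val_zero, Matrix.cons_val_one, Matrix.cons_val_two, Matrix.head_cons, Matrix.tail_cons] at hexp
  rw [real_inner_comm (cross m n) m, real_inner_comm (cross m n) n, NormalVariationRigidity.inner_cross_self_left,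
    TransverseReductionRCensus.inner_cross_self_right, zero_smul,
    zero_smul, add_zero, add_zero, real_inner_comm (cross m n) d] at hexp
  have hd : ‖d‖ = 1 := by simpa using hon.1 0
  have hm : ‖m‖ = 1 := by simpa using hon.1 1
  have hn : ‖n‖ = 1 := by simpa using hon.1 2
  have hmn : ⟪m, n⟫_ℝ = 0 := by simpa using hon.2 (show (1 : Fin 3) ≠ 2 by decide)
  refine ⟨hexp.symm, ?_⟩
  have h1 : ‖cross m n‖ ^ 2 = 1 := by rw [VortexStretchingDynamics.norm_cross_sq, hm, hn, hmn]; norm_num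
  have h2 : ‖cross m n‖ ^ 2 = ⟪cross m n, d⟫_ℝ ^ 2 := by
    conv_lhs => rw [← hexp]
    rw [norm_smul, mul_pow, hd, Real.norm_eq_abs, sq_abs]
    ring
  rw [← h2, h1]

/-- `ε² = 1` for the orientation sign `ε = ⟨m × n, d⟩` of an orthonormal frame. -/
theorem orientationSign_sq {d m n : EuclideanSpace ℝ (Fin 3)} (hon : Orthonormal ℝ ![d, m, n]) : ⟪cross m n, d⟫_ℝ ^ 2 = 1 :=
  (cross_eq_orientationSign_smul hon).2

/-- **Frame form of the axial vorticity**: `⟨curl W y, d⟩ = ε (⟨n, DW(y) m⟩ − ⟨m, DW(y) n⟩)`, `ε = ⟨m × n, d⟩`. -/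
theorem inner_curl_axis_eq {d m n : EuclideanSpace ℝ (Fin 3)} (hon : Orthonormal ℝ ![d, m, n])
    (W : EuclideanSpace ℝ (Fin 3) → EuclideanSpace ℝ (Fin 3)) (y : EuclideanSpace ℝ (Fin 3)) :
    ⟪curl W y, d⟫_ℝ = ⟪cross m n, d⟫_ℝ * (⟪n, fderiv ℝ W y m⟫_ℝ - ⟪m, fderiv ℝ W y n⟫_ℝ) := by
  obtain ⟨hc, hsq⟩ := cross_eq_orientationSign_smul hon
  have h := inner_cross_curl m n W y
  rw [hc, real_inner_smul_left, real_inner_comm (curl W y) d] at h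
  -- `ε ⟨curl, d⟩ = RHS₀`, multiply by `ε` and use `ε² = 1`
  calc ⟪curl W y, d⟫_ℝ = ⟪cross m n, d⟫_ℝ ^ 2 * ⟪curl W y, d⟫_ℝ := by rw [hsq, one_mul]
    _ = ⟪cross m n, d⟫_ℝ * (⟪cross m n, d⟫_ℝ * ⟪curl W y, d⟫_ℝ) := by ring
    _ = _ := by rw [h]

/-! ## 2. The section map `ξ ↦ secPt d m n τ ξ`: chain rule, weight, compact support -/

/-- The section map is affine in `ξ` with differential `h ↦ h₀ m + h₁ n`. -/
theorem hasFDerivAt_secPt (d m n : EuclideanSpace ℝ (Fin 3)) (τ : ℝ) (ξ : EuclideanSpace ℝ (Fin 2)) :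
    HasFDerivAt (fun ξ : EuclideanSpace ℝ (Fin 2) => secPt d m n τ ξ)
      ((EuclideanSpace.proj (0 : Fin 2) : EuclideanSpace ℝ (Fin 2) →L[ℝ] ℝ).smulRight m +
        (EuclideanSpace.proj (1 : Fin 2) : EuclideanSpace ℝ (Fin 2) →L[ℝ] ℝ).smulRight n) ξ := by
  have h0 : HasFDerivAt (fun ξ : EuclideanSpace ℝ (Fin 2) => ξ 0 • m)
      ((EuclideanSpace.proj (0 : Fin 2) : EuclideanSpace ℝ (Fin 2) →L[ℝ] ℝ).smulRight m) ξ :=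
    ((EuclideanSpace.proj (0 : Fin 2) : EuclideanSpace ℝ (Fin 2) →L[ℝ] ℝ).hasFDerivAt).smul_const m
  have h1 : HasFDerivAt (fun ξ : EuclideanSpace ℝ (Fin 2) => ξ 1 • n)
      ((EuclideanSpace.proj (1 : Fin 2) : EuclideanSpace ℝ (Fin 2) →L[ℝ] ℝ).smulRight n) ξ :=
    ((EuclideanSpace.proj (1 : Fin 2) : EuclideanSpace ℝ (Fin 2) →L[ℝ] ℝ).hasFDerivAt).smul_const n
  have h := (h0.add h1).const_add (τ • d)
  have he : (fun ξ : EuclideanSpace ℝ (Fin 2) => secPt d m n τ ξ) = fun ξ => τ • d + (ξ 0 • m + ξ 1 • n) := by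
    funext ξ; simp only [secPt, add_assoc]
  rw [he]
  exact h

/-- The differential of the section map sends `h` to `h₀ m + h₁ n`. -/
theorem secDiff_apply (m n : EuclideanSpace ℝ (Fin 3)) (h : EuclideanSpace ℝ (Fin 2)) :
    ((EuclideanSpace.proj (0 : Fin 2) : EuclideanSpace ℝ (Fin 2) →L[ℝ] ℝ).smulRight m +
        (EuclideanSpace.proj (1 : Fin 2) : EuclideanSpace ℝ (Fin 2) →L[ℝ] ℝ).smulRight n) h = h 0 • m + h 1 • n := by
  simp [ContinuousLinearMap.smulRight_apply]

/-- The section map is smooth (affine). -/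
theorem contDiff_secPt (d m n : EuclideanSpace ℝ (Fin 3)) (τ : ℝ) {k : WithTop ℕ∞} :
    ContDiff ℝ k (fun ξ : EuclideanSpace ℝ (Fin 2) => secPt d m n τ ξ) := by
  have he : (fun ξ : EuclideanSpace ℝ (Fin 2) => secPt d m n τ ξ) = fun ξ => τ • d +
      ((EuclideanSpace.proj (0 : Fin 2) : EuclideanSpace ℝ (Fin 2) →L[ℝ] ℝ).smulRight m +
        (EuclideanSpace.proj (1 : Fin 2) : EuclideanSpace ℝ (Fin 2) →L[ℝ] ℝ).smulRight n) ξ := by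
    funext ξ; rw [secDiff_apply]; simp only [secPt, add_assoc]
  rw [he]
  exact contDiff_const.add (ContinuousLinearMap.contDiff _)

/-- A scalar component `ξ ↦ ⟨u, W(secPt d m n τ ξ)⟩` of a `C¹` field along the section is `C¹`. -/
theorem contDiff_inner_comp_secPt {W : EuclideanSpace ℝ (Fin 3) → EuclideanSpace ℝ (Fin 3)} (hW : ContDiff ℝ 1 W)
    (u d m n : EuclideanSpace ℝ (Fin 3)) (τ : ℝ) :
    ContDiff ℝ 1 (fun ξ : EuclideanSpace ℝ (Fin 2) => ⟪u, W (secPt d m n τ ξ)⟫_ℝ) :=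
  (innerSL ℝ u).contDiff.comp (hW.comp (contDiff_secPt d m n τ))

/-- **Chain rule along the section**: `∂_h ⟨u, W(secPt τ ξ)⟩ = ⟨u, DW(y)(h₀ m + h₁ n)⟩`, `y = secPt d m n τ ξ`. -/
theorem fderiv_inner_comp_secPt {W : EuclideanSpace ℝ (Fin 3) → EuclideanSpace ℝ (Fin 3)} (hW : ContDiff ℝ 1 W)
    (u d m n : EuclideanSpace ℝ (Fin 3)) (τ : ℝ) (ξ h : EuclideanSpace ℝ (Fin 2)) :
    fderiv ℝ (fun ξ : EuclideanSpace ℝ (Fin 2) => ⟪u, W (secPt d m n τ ξ)⟫_ℝ) ξ h =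
      ⟪u, fderiv ℝ W (secPt d m n τ ξ) (h 0 • m + h 1 • n)⟫_ℝ := by
  have hWd : HasFDerivAt W (fderiv ℝ W (secPt d m n τ ξ)) (secPt d m n τ ξ) :=
    ((hW.differentiable one_ne_zero) _).hasFDerivAt
  have hc := (innerSL ℝ u).hasFDerivAt.comp ξ (hWd.comp ξ (hasFDerivAt_secPt d m n τ ξ))
  rw [show (fun ξ : EuclideanSpace ℝ (Fin 2) => ⟪u, W (secPt d m n τ ξ)⟫_ℝ) =
      (innerSL ℝ u) ∘ (W ∘ fun ξ : EuclideanSpace ℝ (Fin 2) => secPt d m n τ ξ) from rfl, hc.fderiv]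
  rw [ContinuousLinearMap.comp_apply, ContinuousLinearMap.comp_apply, secDiff_apply, innerSL_apply_apply]

/-- The `m`-derivative of a component along the section: `∂₀ ⟨u, W∘secPt⟩ (ξ) = ⟨u, DW(y) m⟩`. -/
theorem fderiv_inner_comp_secPt_single₀ {W : EuclideanSpace ℝ (Fin 3) → EuclideanSpace ℝ (Fin 3)} (hW : ContDiff ℝ 1 W)
    (u d m n : EuclideanSpace ℝ (Fin 3)) (τ : ℝ) (ξ : EuclideanSpace ℝ (Fin 2)) :
    fderiv ℝ (fun ξ : EuclideanSpace ℝ (Fin 2) => ⟪u, W (secPt d m n τ ξ)⟫_ℝ) ξ (EuclideanSpace.single 0 1) =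
      ⟪u, fderiv ℝ W (secPt d m n τ ξ) m⟫_ℝ := by
  rw [fderiv_inner_comp_secPt hW]
  simp

/-- The `n`-derivative of a component along the section: `∂₁ ⟨u, W∘secPt⟩ (ξ) = ⟨u, DW(y) n⟩`. -/
theorem fderiv_inner_comp_secPt_single₁ {W : EuclideanSpace ℝ (Fin 3) → EuclideanSpace ℝ (Fin 3)} (hW : ContDiff ℝ 1 W)
    (u d m n : EuclideanSpace ℝ (Fin 3)) (τ : ℝ) (ξ : EuclideanSpace ℝ (Fin 2)) :
    fderiv ℝ (fun ξ : EuclideanSpace ℝ (Fin 2) => ⟪u, W (secPt d m n τ ξ)⟫_ℝ) ξ (EuclideanSpace.single 1 1) =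
      ⟪u, fderiv ℝ W (secPt d m n τ ξ) n⟫_ℝ := by
  rw [fderiv_inner_comp_secPt hW]
  simp

/-- The six scalar facts of an orthonormal frame `(d; m, n)`. -/
theorem frame_inner_eqs {d m n : EuclideanSpace ℝ (Fin 3)} (hon : Orthonormal ℝ ![d, m, n]) :
    ⟪d, d⟫_ℝ = 1 ∧ ⟪m, m⟫_ℝ = 1 ∧ ⟪n, n⟫_ℝ = 1 ∧ ⟪d, m⟫_ℝ = 0 ∧ ⟪d, n⟫_ℝ = 0 ∧ ⟪m, n⟫_ℝ = 0 := by
  have hd : ‖d‖ = 1 := by simpa using hon.1 0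
  have hm : ‖m‖ = 1 := by simpa using hon.1 1
  have hn : ‖n‖ = 1 := by simpa using hon.1 2
  have hdm : ⟪d, m⟫_ℝ = 0 := by simpa using hon.2 (show (0 : Fin 3) ≠ 1 by decide)
  have hdn : ⟪d, n⟫_ℝ = 0 := by simpa using hon.2 (show (0 : Fin 3) ≠ 2 by decide)
  have hmn : ⟪m, n⟫_ℝ = 0 := by simpa using hon.2 (show (1 : Fin 3) ≠ 2 by decide)
  refine ⟨?_, ?_, ?_, hdm, hdn, hmn⟩
  · rw [real_inner_self_eq_norm_sq, hd]; norm_num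
  · rw [real_inner_self_eq_norm_sq, hm]; norm_num
  · rw [real_inner_self_eq_norm_sq, hn]; norm_num

/-- On the section the axial coordinate is `τ`: `⟨secPt d m n τ ξ, d⟩ = τ`. -/
theorem inner_secPt_axis {d m n : EuclideanSpace ℝ (Fin 3)} (hon : Orthonormal ℝ ![d, m, n]) (τ : ℝ) (ξ : EuclideanSpace ℝ (Fin 2)) :
    ⟪secPt d m n τ ξ, d⟫_ℝ = τ := by
  obtain ⟨hdd, -, -, hdm, hdn, -⟩ := frame_inner_eqs hon
  have hmd : ⟪m, d⟫_ℝ = 0 := by rw [real_inner_comm]; exact hdm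
  have hnd : ⟪n, d⟫_ℝ = 0 := by rw [real_inner_comm]; exact hdn
  simp only [secPt, inner_add_left, real_inner_smul_left, hdd, hmd, hnd]
  ring

/-- On the section `|y|² = τ² + |ξ|²`. -/
theorem norm_secPt_sq {d m n : EuclideanSpace ℝ (Fin 3)} (hon : Orthonormal ℝ ![d, m, n]) (τ : ℝ) (ξ : EuclideanSpace ℝ (Fin 2)) :
    ‖secPt d m n τ ξ‖ ^ 2 = τ ^ 2 + ‖ξ‖ ^ 2 := by
  obtain ⟨hdd, hmm, hnn, hdm, hdn, hmn⟩ := frame_inner_eqs hon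
  have hξ : ‖ξ‖ ^ 2 = ξ 0 ^ 2 + ξ 1 ^ 2 := by
    rw [EuclideanSpace.norm_sq_eq, Fin.sum_univ_two, Real.norm_eq_abs, Real.norm_eq_abs, sq_abs, sq_abs]
  have hmd : ⟪m, d⟫_ℝ = 0 := by rw [real_inner_comm]; exact hdm
  have hnd : ⟪n, d⟫_ℝ = 0 := by rw [real_inner_comm]; exact hdn
  have hnm : ⟪n, m⟫_ℝ = 0 := by rw [real_inner_comm]; exact hmn
  rw [hξ, ← real_inner_self_eq_norm_sq]
  simp only [secPt, inner_add_left, inner_add_right, real_inner_smul_left, real_inner_smul_right, hdd, hmm, hnn, hdm, hdn, hmn,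
    hmd, hnd, hnm]
  ring

/-- **The sectional weight on the section is `1 + |ξ|²`**: `secWt d (secPt d m n τ ξ) = 1 + |ξ|²`; in particular
`|y|² − ⟨y,d⟩² = |ξ|²` there. -/
theorem secWt_secPt {d m n : EuclideanSpace ℝ (Fin 3)} (hon : Orthonormal ℝ ![d, m, n]) (τ : ℝ) (ξ : EuclideanSpace ℝ (Fin 2)) :
    secWt d (secPt d m n τ ξ) = 1 + ‖ξ‖ ^ 2 ∧ ‖secPt d m n τ ξ‖ ^ 2 - ⟪secPt d m n τ ξ, d⟫_ℝ ^ 2 = ‖ξ‖ ^ 2 := by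
  rw [secWt, norm_secPt_sq hon, inner_secPt_axis hon]
  constructor <;> ring

/-- **Compact support of the section trace**: if `W` vanishes outside the sectional cylinder of radius `R` about `ℝd`, then
`ξ ↦ W (secPt d m n τ ξ)` vanishes outside the closed disc of radius `|R|`, hence has compact support. -/
theorem hasCompactSupport_comp_secPt {d m n : EuclideanSpace ℝ (Fin 3)} (hon : Orthonormal ℝ ![d, m, n])
    {W : EuclideanSpace ℝ (Fin 3) → EuclideanSpace ℝ (Fin 3)} {R : ℝ} (hsupp : ∀ y, R ^ 2 ≤ ‖y‖ ^ 2 - ⟪y, d⟫_ℝ ^ 2 → W y = 0)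
    (τ : ℝ) : HasCompactSupport (fun ξ : EuclideanSpace ℝ (Fin 2) => W (secPt d m n τ ξ)) := by
  refine HasCompactSupport.intro (isCompact_closedBall (0 : EuclideanSpace ℝ (Fin 2)) |R|) fun ξ hξ => ?_
  rw [Metric.mem_closedBall, dist_zero_right, not_le] at hξ
  apply hsupp
  rw [(secWt_secPt hon τ ξ).2, ← sq_abs R]
  exact pow_le_pow_left₀ (abs_nonneg R) hξ.le 2

/-- Compact support of a scalar component along the section. -/
theorem hasCompactSupport_inner_comp_secPt {d m n : EuclideanSpace ℝ (Fin 3)} (hon : Orthonormal ℝ ![d, m, n])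
    {W : EuclideanSpace ℝ (Fin 3) → EuclideanSpace ℝ (Fin 3)} {R : ℝ} (hsupp : ∀ y, R ^ 2 ≤ ‖y‖ ^ 2 - ⟪y, d⟫_ℝ ^ 2 → W y = 0)
    (u : EuclideanSpace ℝ (Fin 3)) (τ : ℝ) :
    HasCompactSupport (fun ξ : EuclideanSpace ℝ (Fin 2) => ⟪u, W (secPt d m n τ ξ)⟫_ℝ) :=
  (hasCompactSupport_comp_secPt hon hsupp τ).comp_left (g := fun v : EuclideanSpace ℝ (Fin 3) => ⟪u, v⟫_ℝ) (inner_zero_right u)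

/-! ## 3. Integration by parts in the section (from Mathlib's `integral_mul_fderiv_eq_neg_fderiv_mul_of_integrable`) -/

/-- `∫ p ∂_v w = −∫ (∂_v p) w` on `ℝ²` for `C¹` functions `p, w` with `w` compactly supported (any growth of `p`). -/
theorem integral_mul_fderiv_apply_eq_neg {p w : EuclideanSpace ℝ (Fin 2) → ℝ} (hp : ContDiff ℝ 1 p) (hw : ContDiff ℝ 1 w)
    (hwc : HasCompactSupport w) (v : EuclideanSpace ℝ (Fin 2)) :
    ∫ ξ, p ξ * fderiv ℝ w ξ v = -∫ ξ, fderiv ℝ p ξ v * w ξ := by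
  have hpd : Continuous fun ξ => fderiv ℝ p ξ v := (hp.continuous_fderiv one_ne_zero).clm_apply continuous_const
  have hwd : Continuous fun ξ => fderiv ℝ w ξ v := (hw.continuous_fderiv one_ne_zero).clm_apply continuous_const
  exact integral_mul_fderiv_eq_neg_fderiv_mul_of_integrable (μ := volume) (f := p) (g := w) (v := v)
    ((hpd.mul hw.continuous).integrable_of_hasCompactSupport hwc.mul_left)
    ((hp.continuous.mul hwd).integrable_of_hasCompactSupport ((hwc.fderiv_apply (𝕜 := ℝ) v).mul_left))
    ((hp.continuous.mul hw.continuous).integrable_of_hasCompactSupport hwc.mul_left)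
    (fun x _ => (hp.differentiable one_ne_zero) x) (fun x _ => (hw.differentiable one_ne_zero) x)

/-- `∫ ∂_v w = 0` on `ℝ²` for a compactly supported `C¹` function. -/
theorem integral_fderiv_apply_eq_zero₂ {w : EuclideanSpace ℝ (Fin 2) → ℝ} (hw : ContDiff ℝ 1 w) (hwc : HasCompactSupport w)
    (v : EuclideanSpace ℝ (Fin 2)) : ∫ ξ, fderiv ℝ w ξ v = 0 := by
  have h := integral_mul_fderiv_apply_eq_neg (p := fun _ => (1 : ℝ)) contDiff_const hw hwc v
  simpa using h

/-- The coordinate functions of the section and their derivatives along the frame directions. -/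
theorem hasFDerivAt_coord (i : Fin 2) (ξ : EuclideanSpace ℝ (Fin 2)) :
    HasFDerivAt (fun ξ : EuclideanSpace ℝ (Fin 2) => ξ i) (EuclideanSpace.proj i : EuclideanSpace ℝ (Fin 2) →L[ℝ] ℝ) ξ :=
  (EuclideanSpace.proj i : EuclideanSpace ℝ (Fin 2) →L[ℝ] ℝ).hasFDerivAt

/-- `ξ ↦ ξᵢ` is smooth. -/
theorem contDiff_coord (i : Fin 2) {k : WithTop ℕ∞} : ContDiff ℝ k (fun ξ : EuclideanSpace ℝ (Fin 2) => ξ i) :=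
  (EuclideanSpace.proj i : EuclideanSpace ℝ (Fin 2) →L[ℝ] ℝ).contDiff

/-- `∂_{e_j} ξᵢ = δᵢⱼ`. -/
theorem fderiv_coord_single (i j : Fin 2) (ξ : EuclideanSpace ℝ (Fin 2)) :
    fderiv ℝ (fun ξ : EuclideanSpace ℝ (Fin 2) => ξ i) ξ (EuclideanSpace.single j 1) = if i = j then 1 else 0 := by
  rw [(hasFDerivAt_coord i ξ).fderiv]
  simp

/-- `∂_{e₀}(ξ₀ξ₁) = ξ₁`, `∂_{e₁}(ξ₀ξ₁) = ξ₀`. -/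
theorem fderiv_coord_mul (ξ : EuclideanSpace ℝ (Fin 2)) :
    fderiv ℝ (fun ξ : EuclideanSpace ℝ (Fin 2) => ξ 0 * ξ 1) ξ (EuclideanSpace.single 0 1) = ξ 1 ∧
      fderiv ℝ (fun ξ : EuclideanSpace ℝ (Fin 2) => ξ 0 * ξ 1) ξ (EuclideanSpace.single 1 1) = ξ 0 := by
  have h := ((hasFDerivAt_coord 0 ξ).mul (hasFDerivAt_coord 1 ξ)).fderiv
  rw [show (fun ξ : EuclideanSpace ℝ (Fin 2) => ξ 0 * ξ 1) =
    ((fun ξ : EuclideanSpace ℝ (Fin 2) => ξ 0) * fun ξ : EuclideanSpace ℝ (Fin 2) => ξ 1) from rfl, h]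
  constructor <;> simp

/-- `∂_{e₀}(ξ₀² − ξ₁²) = 2ξ₀`, `∂_{e₁}(ξ₀² − ξ₁²) = −2ξ₁`. -/
theorem fderiv_coord_sq_sub (ξ : EuclideanSpace ℝ (Fin 2)) :
    fderiv ℝ (fun ξ : EuclideanSpace ℝ (Fin 2) => ξ 0 ^ 2 - ξ 1 ^ 2) ξ (EuclideanSpace.single 0 1) = 2 * ξ 0 ∧
      fderiv ℝ (fun ξ : EuclideanSpace ℝ (Fin 2) => ξ 0 ^ 2 - ξ 1 ^ 2) ξ (EuclideanSpace.single 1 1) = -(2 * ξ 1) := by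
  have h := (((hasFDerivAt_coord 0 ξ).mul (hasFDerivAt_coord 0 ξ)).sub
    ((hasFDerivAt_coord 1 ξ).mul (hasFDerivAt_coord 1 ξ))).fderiv
  have he : (fun ξ : EuclideanSpace ℝ (Fin 2) => ξ 0 ^ 2 - ξ 1 ^ 2) =
      ((fun ξ : EuclideanSpace ℝ (Fin 2) => ξ 0) * fun ξ : EuclideanSpace ℝ (Fin 2) => ξ 0) -
        (fun ξ : EuclideanSpace ℝ (Fin 2) => ξ 1) * fun ξ : EuclideanSpace ℝ (Fin 2) => ξ 1 := by
    funext ξ; simp only [Pi.sub_apply, Pi.mul_apply]; ring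
  rw [he, h]
  constructor <;> simp <;> ring

end Summit.NavierStokesRegularity.NavierStokesRegularity.Theorems.DefectColumnGate

end
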